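import Mathlib
import Summits.ResolutionOfSingularities.ResolutionOfSingularities.Theorems.WeightedInvariantLocalWeightedDropNewtonSetChartLaws
import Summits.ResolutionOfSingularities.ResolutionOfSingularities.Theorems.WeightedInvariantLocalWeightedDropWildMonicFlagDefs

/-!
# `WeightedInvariant.LocalWeightedDrop`, line `hasse-ridge-face-selection`, S3ρ sub-stub S3ρD `stub_wildMonicSurfaceDescent`, case D-a:
# the COORDINATE-FLAG numbers `(d_F, s_F)` under the MONOMIAL POINT STEP — Perlega Prop. 9.1.1 (case `n_F = 0`) on point sets

Crux item stmt-ResolutionOfSingularities-8899 `LocalWeightedDrop` (route `ResolutionOfSingularities/WeightedInvariant`), engine of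
the door `HypersurfaceCentreConstruction` stmt-ResolutionOfSingularities-19897.  [OURS · L1 W4.3, chain w43, res-L1-w43-stub-7 (second
seat on S3ρ under res-type-083; case D-a «`n_F = 0`, `t = 0`» of `L/res-type-083/S3RHO-DESIGN.md` §1(D)).  MODEL: S. Perlega, thesis Wien
2017 / arXiv:2011.14443, Prop. 9.1.1 (first bullet: «If `n_𝓕 = 0`: `n_{𝓕′} = 0`; `d_{𝓕′} ≤ d_𝓕`; if `d_{𝓕′} = d_𝓕` and `s_𝓕 < ∞`, then
`s_{𝓕′} < s_𝓕`»), with Prop. 6.1.1 (1) («`I_{2,x′}(a′)` has the same order as the weak transform of `I_{2,x}(a)`»), Prop. 6.1.3 (1)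
(«`ord J′₁ = ord J₁ − d!`») and Lemma 9.1.2 (the flag along the new exceptional curve); = Hauser–Perlega, Publ. RIMS 60 (2024) Prop. 4
case (i) pp. 794–795 in the purely inseparable case.  PURE COMBINATORICS on point sets `N ⊂ ℕ²` (the `d!`-scaled Newton sets of
`…WildMonicFlagDefs`); the bridge to the game's successor tuple is `…WildMonicNewtonPointStep`.  Nothing here is a statement of
H. Hironaka's manuscript [claim: Hironaka2017, status: under-review], and nothing is asserted about Perlega's text: the theorems below
are about OUR definitions `WildMonic.dRes/sFlag/sComp/sValue`.]

THE STEP.  The monomial point step in the `x₁`-chart (exceptional point ON the axis, `x₁ ↦ s`, `x₂ ↦ s x₂′`; Perlega's / HP's `t = 0`)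
acts on the scaled Newton set by lead-1's chart map `MonicDescent.psi L`, `P ↦ (P₀ + P₁ − L, P₁)`, `L = d!`, and on the boundary by
`excNext` (`V(s)` new, `V(x₂)` kept).  With `r = excExp E N`, `S = N − r` (points of the residual factor `I₂`), `δ = d_F = deltaL S`:
* `reduce_excNext_image_psi` — THE REDUCED SET TRANSFORMS BY ITS OWN WEAK TRANSFORM: `N′ − r′ = Ψ_δ(S)` (`r′ = (deltaL N − L, r₂)`,
  `excExp_excNext_image_psi`); hence `dRes_excNext_image_psi_le`: `d′_F ≤ d_F` (stub-1's (N3) for the pure case included);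
* `coeffOrd_image_psi` — the coefficient-ideal order of a point set under its weak transform: `coeffOrd Q (Ψ_Q T) + Q! = coeffOrd Q T`
  (EVERY term `(Q!/(Q−i))·a` becomes `(Q!/(Q−i))·(a + i − Q)`, i.e. drops by exactly `Q!`); hence, when the order is kept
  (`d′_F = d_F`): `sFlag_excNext_image_psi` (`s′ + d_F! = s`), `compSet_image_psi` / `sComp_excNext_image_psi` (companion case
  `0 < d_F < L`: `s′ + (d_F(L − d_F))! = s`), `exists_sValue_excNext_image_psi_add`, `sValue_excNext_image_psi_lt` (`s′ < s` unless `s = ⊤`);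
* `eq_corner_of_deltaL_image_psi_eq` — if the order is kept, the `δ`-face of `S` is the single corner `(0, δ)` (`in(I₂) = x₂^δ`), and
  `two_mul_deltaL_le_of_deltaL_image_psi_eq` (all of `S` has `(1,2)`-weight `≥ 2δ`); whence `coeffOrd_swap_image_psi_eq`: read with
  respect to the OTHER letter (the flag whose curve is the new exceptional curve) the weak transform has the MINIMAL coefficient order
  `δ!` (`factorial_le_coeffOrd` is the lower bound for every flag) — that flag never beats the induced one (Lemma 9.1.2);
* `coeffOrd_eq_top_iff` — `s = ⊤` iff no point lies below the row `δ` (`I₂ ⊆ (x₂^δ)`: with `δ = ord I₂` the monomial case).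
Hypotheses throughout: `N` nonempty and `L ≤ P₀ + P₁` on `N` (for a position, `…NewtonPointStep.factorial_lt_of_mem_newtonSet`).
-/

set_option linter.dupNamespace false -- mandated namespace of this single-conjunct summit

namespace Summit.ResolutionOfSingularities.ResolutionOfSingularities.Theorems

namespace WildMonic

open MonicDescent

variable {N S T : Set (Fin 2 →₀ ℕ)}

/-! ## The weak transform `psi (deltaL S)` of a point set (`c`-general laws of `psi` are res-L1-type-o7's `…NewtonSetChartLaws`) -/

/-- `δ(Ψ_δ S) ≤ δ(S)` for `δ = δ(S)`: the weak transform does not raise the order (image of a point of the `δ`-face). -/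
theorem deltaL_image_psi_self_le (hS : S.Nonempty) : deltaL (psi (deltaL S) '' S) ≤ deltaL S := by
  obtain ⟨P, hP, hPd⟩ := exists_eq_deltaL hS
  have h := deltaL_le (N := psi (deltaL S) '' S) ⟨P, hP, rfl⟩
  rw [psi_apply_zero, psi_apply_one] at h
  omega

/-- If the order is KEPT, `δ(Ψ_δ S) = δ(S) = δ`, then every point of the `δ`-face of `S` is the corner `(0, δ)` (the initial form
of the residual factor is `x₂^δ`; Perlega Lemma 9.1.2's «directrix `(ȳ^d)`»). -/
theorem eq_corner_of_deltaL_image_psi_eq (hkeep : deltaL (psi (deltaL S) '' S) = deltaL S) {P : Fin 2 →₀ ℕ} (hP : P ∈ S)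
    (hPd : P 0 + P 1 = deltaL S) : P 0 = 0 ∧ P 1 = deltaL S := by
  have h := deltaL_le (N := psi (deltaL S) '' S) ⟨P, hP, rfl⟩
  rw [psi_apply_zero, psi_apply_one, hkeep] at h
  omega

/-- If the order is kept, ALL points of `S` lie on or above the line `P₀ + 2 P₁ = 2δ` (weighted order `(1,2)` at least `2δ`). -/
theorem two_mul_deltaL_le_of_deltaL_image_psi_eq (hkeep : deltaL (psi (deltaL S) '' S) = deltaL S) {P : Fin 2 →₀ ℕ}
    (hP : P ∈ S) : 2 * deltaL S ≤ P 0 + 2 * P 1 := by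
  have h := deltaL_le (N := psi (deltaL S) '' S) ⟨P, hP, rfl⟩
  rw [psi_apply_zero, psi_apply_one, hkeep] at h
  have := deltaL_le hP
  omega

/-! ## The exceptional exponents and the reduced set -/

/-- The exceptional exponents lie below every point. -/
theorem excExp_le {E : Finset (Fin 2)} {P : Fin 2 →₀ ℕ} (hP : P ∈ N) (i : Fin 2) : excExp E N i ≤ P i := by
  fin_cases i
  · simp only [Fin.zero_eta, excExp_apply_zero]
    split_ifs
    · exact alphaL_le hP
    · exact Nat.zero_le _
  · simp only [Fin.mk_one, excExp_apply_one]
    split_ifs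
    · exact epsL_le hP
    · exact Nat.zero_le _

/-- The reduced set of a nonempty set is nonempty. -/
theorem reduce_nonempty (r : Fin 2 →₀ ℕ) (hN : N.Nonempty) : (reduce r N).Nonempty := hN.image _

/-- `d_F + r₁ + r₂ = δ(N)`: the order of `J₂ = M₂ · I₂` splits (HP p. 776 «`d_res = ord G = ord F − ord_{E_a} F`»). -/
theorem dRes_add_excExp (E : Finset (Fin 2)) (hN : N.Nonempty) :
    dRes E N + excExp E N 0 + excExp E N 1 = deltaL N := by
  unfold dRes
  apply le_antisymm
  · obtain ⟨P, hP, hPd⟩ := exists_eq_deltaL hN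
    have h := deltaL_le (N := reduce (excExp E N) N) ⟨P, hP, rfl⟩
    simp only [Finsupp.tsub_apply] at h
    have h0 := excExp_le (E := E) hP 0
    have h1 := excExp_le (E := E) hP 1
    omega
  · obtain ⟨Q, ⟨P, hP, rfl⟩, hQd⟩ := exists_eq_deltaL (reduce_nonempty (excExp E N) hN)
    simp only [Finsupp.tsub_apply] at hQd
    have h := deltaL_le hP
    have h0 := excExp_le (E := E) hP 0
    have h1 := excExp_le (E := E) hP 1
    omega

/-- Every point of the reduced set has total degree at least `d_F`. -/
theorem dRes_le_of_mem_reduce {E : Finset (Fin 2)} {Q : Fin 2 →₀ ℕ} (hQ : Q ∈ reduce (excExp E N) N) :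
    dRes E N ≤ Q 0 + Q 1 := deltaL_le hQ

/-- The exceptional exponents AFTER the monomial point step in the `x₁`-chart: `r′₁ = δ(N) − L` (the whole order of `J₂` moves into
the new exceptional letter) and `r′₂ = r₂`. -/
theorem excExp_excNext_image_psi (E : Finset (Fin 2)) (L : ℕ) (hN : N.Nonempty) :
    excExp (excNext E) (psi L '' N) 0 = deltaL N - L ∧ excExp (excNext E) (psi L '' N) 1 = excExp E N 1 := by
  constructor
  · rw [excExp_apply_zero, if_pos ((mem_excNext_iff E 0).mpr (Or.inl rfl)), alphaL_image_psiC L hN]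
  · rw [excExp_apply_one, excExp_apply_one, epsL_image_psiC]
    have h1 : ((1 : Fin 2) ∈ excNext E) ↔ (1 : Fin 2) ∈ E := by
      rw [mem_excNext_iff]; simp
    by_cases hE : (1 : Fin 2) ∈ E
    · rw [if_pos (h1.mpr hE), if_pos hE]
    · rw [if_neg (fun h => hE (h1.mp h)), if_neg hE]

/-- THE REDUCED SET TRANSFORMS BY ITS OWN WEAK TRANSFORM: after the monomial point step in the `x₁`-chart (scale `L ≤` every total
degree), the reduced set of the successor for the successor boundary is `Ψ_{d_F}` of the reduced set (Perlega Prop. 6.1.1 (1) / HP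
Prop. 4 (i): «`I_{2,x′}(a′)` is the weak transform of `I_{2,x}(a)`», `G′ = x^{−d_res} G(x, xy)`). -/
theorem reduce_excNext_image_psi (E : Finset (Fin 2)) {L : ℕ} (hN : N.Nonempty) (hL : ∀ P ∈ N, L ≤ P 0 + P 1) :
    reduce (excExp (excNext E) (psi L '' N)) (psi L '' N) = psi (dRes E N) '' reduce (excExp E N) N := by
  obtain ⟨hr0, hr1⟩ := excExp_excNext_image_psi E L hN
  have hsum := dRes_add_excExp E hN
  have hLδ : L ≤ deltaL N := by
    obtain ⟨R, hR, hRd⟩ := exists_eq_deltaL hN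
    have := hL R hR
    omega
  have hpt : ∀ P ∈ N, psi L P - excExp (excNext E) (psi L '' N) = psi (dRes E N) (P - excExp E N) := by
    intro P hP
    have h0 := excExp_le (E := E) hP 0
    have h1 := excExp_le (E := E) hP 1
    have hd := deltaL_le hP
    ext i
    fin_cases i
    · simp only [Fin.zero_eta, psi_apply_zero, Finsupp.tsub_apply, hr0]
      omega
    · simp only [Fin.mk_one, psi_apply_one, Finsupp.tsub_apply, hr1]
  ext Q
  simp only [reduce, Set.mem_image, exists_exists_and_eq_and]
  constructor
  · rintro ⟨P, hP, rfl⟩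
    exact ⟨P, hP, (hpt P hP).symm⟩
  · rintro ⟨P, hP, rfl⟩
    exact ⟨P, hP, hpt P hP⟩

/-- `d′_F ≤ d_F` UNDER THE MONOMIAL POINT STEP (Perlega Prop. 9.1.1, case `n_F = 0`: «`d_{F′} ≤ d_F`»; HP p. 779 «If `t = 0` … it is
immediate to see that `d′_res ≤ d_res`»; stub-1's (N3)). -/
theorem dRes_excNext_image_psi_le (E : Finset (Fin 2)) {L : ℕ} (hN : N.Nonempty) (hL : ∀ P ∈ N, L ≤ P 0 + P 1) :
    dRes (excNext E) (psi L '' N) ≤ dRes E N := by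
  conv_lhs => unfold dRes
  rw [reduce_excNext_image_psi E hN hL]
  exact deltaL_image_psi_self_le (reduce_nonempty _ hN)

/-! ## The coefficient-ideal order of a point set and its transport -/

/-- Upper bound: every point below the row `δ` bounds `coeffOrd`. -/
theorem coeffOrd_le {δ : ℕ} {P : Fin 2 →₀ ℕ} (hP : P ∈ S) (h1 : P 1 < δ) :
    coeffOrd δ S ≤ ((δ.factorial / (δ - P 1) * P 0 : ℕ) : ℕ∞) :=
  iInf₂_le P ⟨hP, h1⟩

/-- Lower bounds for `coeffOrd` are checked pointwise. -/
theorem le_coeffOrd_iff {δ : ℕ} {x : ℕ∞} :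
    x ≤ coeffOrd δ S ↔ ∀ P ∈ S, P 1 < δ → x ≤ ((δ.factorial / (δ - P 1) * P 0 : ℕ) : ℕ∞) := by
  unfold coeffOrd
  simp only [le_iInf_iff, Set.mem_setOf_eq, and_imp]

/-- `coeffOrd δ S = ⊤` iff no point of `S` lies strictly below the row `P₁ = δ` (`I ⊆ (x₂^δ)`: for the coordinate flag this is the
monomial case once `δ = ord I`). -/
theorem coeffOrd_eq_top_iff {δ : ℕ} : coeffOrd δ S = ⊤ ↔ ∀ P ∈ S, δ ≤ P 1 := by
  constructor
  · intro h P hP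
    by_contra hlt
    have hle := coeffOrd_le hP (not_le.mp hlt)
    rw [h, top_le_iff] at hle
    exact ENat.coe_ne_top _ hle
  · intro h
    unfold coeffOrd
    simp only [iInf_eq_top, Set.mem_setOf_eq, and_imp]
    intro P hP hlt
    exact absurd hlt (not_lt.mpr (h P hP))

/-- THE MINIMAL VALUE: if every point has total degree at least `δ`, then `δ! ≤ coeffOrd δ S` (a point `(a, i)` with `i < δ`,
`a + i ≥ δ` contributes `(δ!/(δ−i)) · a ≥ δ!`). -/
theorem factorial_le_coeffOrd {δ : ℕ} (hS : ∀ P ∈ S, δ ≤ P 0 + P 1) : ((δ.factorial : ℕ) : ℕ∞) ≤ coeffOrd δ S := by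
  rw [le_coeffOrd_iff]
  intro P hP h1
  have hsum := hS P hP
  have hdvd : (δ - P 1) ∣ δ.factorial := Nat.dvd_factorial (by omega) (by omega)
  exact_mod_cast calc δ.factorial = δ.factorial / (δ - P 1) * (δ - P 1) := (Nat.div_mul_cancel hdvd).symm
    _ ≤ δ.factorial / (δ - P 1) * P 0 := Nat.mul_le_mul_left _ (by omega)

/-- The arithmetic of the weak transform on one term: `(Q!/(Q−i)) · (a + i − Q) + Q! = (Q!/(Q−i)) · a` for `i < Q ≤ a + i`. -/
theorem factorial_div_mul_psi_add {Q a i : ℕ} (hi : i < Q) (hQ : Q ≤ a + i) :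
    Q.factorial / (Q - i) * (a + i - Q) + Q.factorial = Q.factorial / (Q - i) * a := by
  have hdvd : (Q - i) ∣ Q.factorial := Nat.dvd_factorial (by omega) (by omega)
  nth_rw 2 [← Nat.div_mul_cancel hdvd]
  rw [← Nat.mul_add]
  congr 1
  omega

/-- The index set of `coeffOrd` after `Ψ_Q` is the `Ψ_Q`-image of the index set (the second coordinate is preserved). -/
theorem setOf_mem_image_psi_lt (Q : ℕ) (T : Set (Fin 2 →₀ ℕ)) :
    {P : Fin 2 →₀ ℕ | P ∈ psi Q '' T ∧ P 1 < Q} = psi Q '' {P : Fin 2 →₀ ℕ | P ∈ T ∧ P 1 < Q} := by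
  ext P'
  simp only [Set.mem_setOf_eq, Set.mem_image]
  constructor
  · rintro ⟨⟨P, hP, rfl⟩, h1⟩
    rw [psi_apply_one] at h1
    exact ⟨P, ⟨hP, h1⟩, rfl⟩
  · rintro ⟨P, ⟨hP, h1⟩, rfl⟩
    exact ⟨⟨P, hP, rfl⟩, by rwa [psi_apply_one]⟩

/-- THE COEFFICIENT-IDEAL ORDER UNDER THE WEAK TRANSFORM: if every point of `T` has total degree at least `Q`, then
`coeffOrd Q (Ψ_Q T) + Q! = coeffOrd Q T` — EVERY term drops by exactly `Q!` (Perlega Prop. 6.1.3 (1) «`ord J′₁ = ord J₁ − d!`»;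
HP Prop. 4 (i) «`coeff_{d_𝓖}(G′) = x^{−d_res} · coeff_{d_𝓕}(G)` … this proves that `s_𝓖 < s_𝓕`»). -/
theorem coeffOrd_image_psi (Q : ℕ) (hT : ∀ P ∈ T, Q ≤ P 0 + P 1) :
    coeffOrd Q (psi Q '' T) + (Q.factorial : ℕ∞) = coeffOrd Q T := by
  unfold coeffOrd
  rw [setOf_mem_image_psi_lt, iInf_image, ENat.iInf_add]
  refine iInf_congr fun P => ?_
  rw [ENat.iInf_add]
  refine iInf_congr fun hP => ?_
  rw [psi_apply_zero, psi_apply_one, ← ENat.coe_add, factorial_div_mul_psi_add hP.2 (hT P hP.1)]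

/-! ## The transport laws of the coordinate-flag numbers (Perlega Prop. 9.1.1, case `n_F = 0`) -/

/-- `s′_F + d_F! = s_F` WHEN THE ORDER IS KEPT (`d′_F = d_F ≥ d!` is the case where this entry is used): Perlega Prop. 9.1.1
(«if `d_{F′} = d_F` and `s_F < ∞`, then `s_{F′} < s_F`») with the exact drop of Prop. 6.1.3 (1). -/
theorem sFlag_excNext_image_psi (E : Finset (Fin 2)) {L : ℕ} (hN : N.Nonempty) (hL : ∀ P ∈ N, L ≤ P 0 + P 1)
    (hkeep : dRes (excNext E) (psi L '' N) = dRes E N) :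
    sFlag (excNext E) (psi L '' N) + ((dRes E N).factorial : ℕ∞) = sFlag E N := by
  unfold sFlag
  rw [hkeep, reduce_excNext_image_psi E hN hL]
  exact coeffOrd_image_psi (dRes E N) fun P hP => dRes_le_of_mem_reduce hP

/-- The companion point set transforms by `Ψ_{d_F (L − d_F)}` when the order is kept (`M′₂^{d_F}` and `(I′₂)^{L−d_F}` are the weak
transforms of `M₂^{d_F}`, `I₂^{L−d_F}` with exponent `d_F(L − d_F)`; Perlega Prop. 9.1.1 proof «`P_{2,x′}(a′)` contains the weak
transform of `P_{2,x}(a)`»). -/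
theorem compSet_image_psi {L : ℕ} {r r' : Fin 2 →₀ ℕ} (hkeep : deltaL (psi (deltaL S) '' S) = deltaL S)
    (hδL : deltaL S ≤ L) (hr0 : r' 0 + L = deltaL S + r 0 + r 1) (hr1 : r' 1 = r 1) :
    compSet L r' (psi (deltaL S) '' S) = psi (deltaL S * (L - deltaL S)) '' compSet L r S := by
  unfold compSet
  rw [hkeep, Set.image_insert_eq, Set.image_image, Set.image_image]
  congr 1
  · ext i
    fin_cases i
    · simp only [Fin.zero_eta, Finsupp.smul_apply, smul_eq_mul, psi_apply_zero]
      rw [← Nat.mul_add, ← Nat.mul_sub]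
      congr 1
      omega
    · simp only [Fin.mk_one, Finsupp.smul_apply, smul_eq_mul, psi_apply_one, hr1]
  · refine Set.image_congr' fun P => ?_
    ext i
    fin_cases i
    · simp only [Fin.zero_eta, Finsupp.smul_apply, smul_eq_mul, psi_apply_zero]
      rw [← Nat.mul_add, Nat.mul_sub, Nat.mul_comm (deltaL S) (L - deltaL S)]
    · simp only [Fin.mk_one, Finsupp.smul_apply, smul_eq_mul, psi_apply_one]

/-- Every point of the companion set has total degree at least `d_F (L − d_F)` (scale `L ≤` every total degree of `N`). -/
theorem mul_sub_le_of_mem_compSet (E : Finset (Fin 2)) {L : ℕ} (hN : N.Nonempty) (hL : ∀ P ∈ N, L ≤ P 0 + P 1)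
    {P : Fin 2 →₀ ℕ} (hP : P ∈ compSet L (excExp E N) (reduce (excExp E N) N)) :
    dRes E N * (L - dRes E N) ≤ P 0 + P 1 := by
  have hsum := dRes_add_excExp E hN
  have hLδ : L ≤ deltaL N := by
    obtain ⟨R, hR, hRd⟩ := exists_eq_deltaL hN
    have := hL R hR
    omega
  unfold compSet at hP
  rw [Set.mem_insert_iff, Set.mem_image] at hP
  change P = dRes E N • excExp E N ∨ _ at hP
  rcases hP with rfl | ⟨R, hR, hRP⟩
  · simp only [Finsupp.smul_apply, smul_eq_mul]
    rw [← Nat.mul_add]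
    exact Nat.mul_le_mul_left _ (by omega)
  · change (L - dRes E N) • R = P at hRP
    subst hRP
    simp only [Finsupp.smul_apply, smul_eq_mul]
    rw [← Nat.mul_add, Nat.mul_comm]
    exact Nat.mul_le_mul_left _ (dRes_le_of_mem_reduce hR)

/-- `s′ + (d_F (L − d_F))! = s` IN THE COMPANION CASE `0 < d′_F = d_F < L` (Perlega Prop. 9.1.1 proof «`s_{F′} ≤ s_F − (d(c!−d))!`»;
HP Prop. 4 (i) second display; here with equality, the companion power being read through its Newton dilation). -/
theorem sComp_excNext_image_psi (E : Finset (Fin 2)) {L : ℕ} (hN : N.Nonempty) (hL : ∀ P ∈ N, L ≤ P 0 + P 1)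
    (hkeep : dRes (excNext E) (psi L '' N) = dRes E N) (hδL : dRes E N ≤ L) :
    sComp L (excNext E) (psi L '' N) + ((dRes E N * (L - dRes E N)).factorial : ℕ∞) = sComp L E N := by
  have hsum := dRes_add_excExp E hN
  obtain ⟨hr0, hr1⟩ := excExp_excNext_image_psi E L hN
  have hkeep' : deltaL (psi (dRes E N) '' reduce (excExp E N) N) = dRes E N := by
    have h := hkeep
    conv_lhs at h => unfold dRes
    rwa [reduce_excNext_image_psi E hN hL] at h
  have hLδ : L ≤ deltaL N := by
    obtain ⟨R, hR, hRd⟩ := exists_eq_deltaL hN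
    have := hL R hR
    omega
  have hr0' : excExp (excNext E) (psi L '' N) 0 + L =
      deltaL (reduce (excExp E N) N) + excExp E N 0 + excExp E N 1 := by
    rw [hr0]; unfold dRes at hsum; omega
  unfold sComp
  rw [hkeep, reduce_excNext_image_psi E hN hL]
  unfold dRes at hkeep' hδL ⊢
  rw [compSet_image_psi hkeep' hδL hr0' hr1]
  exact coeffOrd_image_psi _ fun P hP => mul_sub_le_of_mem_compSet E hN hL hP

/-- THE `s`-ENTRY DROPS when the order is kept and positive: `sValue′ + n = sValue` for some `n ≥ 1` (`n = d_F!` resp.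
`(d_F(L−d_F))!`). -/
theorem exists_sValue_excNext_image_psi_add (E : Finset (Fin 2)) {L : ℕ} (hN : N.Nonempty) (hL : ∀ P ∈ N, L ≤ P 0 + P 1)
    (hkeep : dRes (excNext E) (psi L '' N) = dRes E N) (hpos : 0 < dRes E N) :
    ∃ n : ℕ, 0 < n ∧ sValue L (excNext E) (psi L '' N) + (n : ℕ∞) = sValue L E N := by
  by_cases hle : L ≤ dRes E N
  · refine ⟨(dRes E N).factorial, Nat.factorial_pos _, ?_⟩
    rw [sValue_of_le hle, sValue_of_le (hkeep.symm ▸ hle)]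
    exact sFlag_excNext_image_psi E hN hL hkeep
  · refine ⟨(dRes E N * (L - dRes E N)).factorial, Nat.factorial_pos _, ?_⟩
    rw [not_le] at hle
    rw [sValue_of_lt hle hpos, sValue_of_lt (hkeep.symm ▸ hle) (hkeep.symm ▸ hpos)]
    exact sComp_excNext_image_psi E hN hL hkeep hle.le

/-- THE `s`-ENTRY DROPS STRICTLY when the order is kept and positive, unless it is infinite (Perlega Prop. 9.1.1 «if `d_{F′} = d_F`
and `s_F < ∞`, then `s_{F′} < s_F`»). -/
theorem sValue_excNext_image_psi_lt (E : Finset (Fin 2)) {L : ℕ} (hN : N.Nonempty) (hL : ∀ P ∈ N, L ≤ P 0 + P 1)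
    (hkeep : dRes (excNext E) (psi L '' N) = dRes E N) (hpos : 0 < dRes E N) (hfin : sValue L E N ≠ ⊤) :
    sValue L (excNext E) (psi L '' N) < sValue L E N := by
  obtain ⟨n, hn, h⟩ := exists_sValue_excNext_image_psi_add E hN hL hkeep hpos
  have hfin' : sValue L (excNext E) (psi L '' N) ≠ ⊤ := by
    intro ht; rw [ht, top_add] at h; exact hfin h.symm
  rw [← h]
  nth_rw 1 [← add_zero (sValue L (excNext E) (psi L '' N))]
  exact (ENat.add_lt_add_iff_left hfin').mpr (by exact_mod_cast hn)

/-! ## The flag along the NEW exceptional curve never wins (Perlega Lemma 9.1.2) -/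

/-- The TRANSPOSE of a point (exchange of the two letters), `Finsupp.equivMapDomain (Equiv.swap 0 1)`: first component. -/
@[simp] theorem swapPt_apply_zero (P : Fin 2 →₀ ℕ) : Finsupp.equivMapDomain (Equiv.swap (0 : Fin 2) 1) P 0 = P 1 := by
  rw [Finsupp.equivMapDomain_apply, Equiv.symm_swap, Equiv.swap_apply_left]

/-- The transpose of a point: second component. -/
@[simp] theorem swapPt_apply_one (P : Fin 2 →₀ ℕ) : Finsupp.equivMapDomain (Equiv.swap (0 : Fin 2) 1) P 1 = P 0 := by
  rw [Finsupp.equivMapDomain_apply, Equiv.symm_swap, Equiv.swap_apply_right]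

/-- WHEN THE ORDER IS KEPT, the coefficient-ideal order of the weak transform read with respect to the OTHER letter (the flag whose
curve is the new exceptional curve `V(x₁′)`) takes the MINIMAL value `δ!` — so that flag's invariant is `≤` the induced flag's
(Perlega Lemma 9.1.2 «If `𝓖` is valid, then `inv(𝓖) ≤ inv(𝓕′)`»; `factorial_le_coeffOrd` is the other half). -/
theorem coeffOrd_swap_image_psi_eq (hS : S.Nonempty) (hkeep : deltaL (psi (deltaL S) '' S) = deltaL S) (hpos : 0 < deltaL S) :
    coeffOrd (deltaL S) (Finsupp.equivMapDomain (Equiv.swap (0 : Fin 2) 1) '' (psi (deltaL S) '' S)) =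
      (deltaL S).factorial := by
  apply le_antisymm
  · obtain ⟨P, hP, hPd⟩ := exists_eq_deltaL hS
    obtain ⟨hP0, hP1⟩ := eq_corner_of_deltaL_image_psi_eq hkeep hP hPd
    have h := coeffOrd_le (S := Finsupp.equivMapDomain (Equiv.swap (0 : Fin 2) 1) '' (psi (deltaL S) '' S)) (δ := deltaL S)
      (P := Finsupp.equivMapDomain (Equiv.swap (0 : Fin 2) 1) (psi (deltaL S) P))
      ⟨psi (deltaL S) P, ⟨P, hP, rfl⟩, rfl⟩ (by rw [swapPt_apply_one, psi_apply_zero]; omega)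
    rw [swapPt_apply_one, swapPt_apply_zero, psi_apply_zero, psi_apply_one, hP0, hP1, zero_add, Nat.sub_self,
      Nat.sub_zero, Nat.div_mul_cancel (Nat.dvd_factorial hpos le_rfl)] at h
    exact h
  · refine factorial_le_coeffOrd fun Q ⟨P', ⟨P, hP, hPP'⟩, hQ⟩ => ?_
    subst hQ; subst hPP'
    rw [swapPt_apply_zero, swapPt_apply_one, psi_apply_one, psi_apply_zero]
    have := two_mul_deltaL_le_of_deltaL_image_psi_eq hkeep hP
    have := deltaL_le hP
    omega

end WildMonic

end Summit.ResolutionOfSingularities.ResolutionOfSingularities.Theorems
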